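import Summits.HodgeConjecture.HodgeConjecture.Theses.CurveNetMordellWeil
import Literature.AlgebraicGeometry.Motives.FamiliesVHS
import Literature.AlgebraicGeometry.HodgeTheory.IsoTransport

/-!
# Line `anchor-transport-42` — crux stmt-HodgeConjecture-2784 `CurveNetMordellWeil.VerticalSupportFourfolds`

Crux-strategist line (WALL-BREAKER pass on an exhausted chain, 2026-08-17). Registered skeleton:
two stubs + the kernel-checked composition `VerticalSupportFourfolds_of`.

THE CRUX IS HC(2,2) FOR ALL SMOOTH PROJECTIVE FOURFOLDS (landed sandwich p106042 +
`CurveNetExists`); two ideation rounds (7 cards) and the lead line `Sketch` died on reformulations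
of that fact (detection duality, good supports, Gram/defect calculus, generic Gauss–Manin) and on
sector levers (g = 1 / moduli rank ≤ 1). This line does NOT reformulate verticality. It is the
`(n, p) = (4, 2)` SLICE of Grothendieck's ANCHOR + TRANSPORT frame (route `AnchorTransport`,
items stmt-HodgeConjecture-1076/1077 there for all `(n,p)`), the one decomposition of the crux into
pieces neither of which is the crux reworded:

* `stub_variationalHodgeFourfolds` (V42) — the VARIATIONAL Hodge conjecture for `(2,2)`-classes in
  smooth projective families of fourfolds over a smooth irreducible base (global-class form).
  Incomparable with the crux (HC ⇒ VHC needs HC in dimension `4 + dim S`). Codimension 2 on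
  fourfolds is where the sheaf engines live: Bloch semiregularity for lci surfaces (tree:
  `BlochSemiregularityTheorem`, `BlochSemiregularSpread`), Buchweitz–Flenner / Pridham for
  sheaves and complexes, Perry's CY2-category deformation (cubic / GM fourfolds) and its 2026
  equivariant version, Markman's transport of Weil classes along the Weil locus.
* `stub_anchorExistenceFourfolds` (An42) — ANCHOR EXISTENCE = geography of Hodge loci of
  `(2,2)`-classes in fourfold families: every `(X⁴, c)` deforms through Hodge classes (up to iso)
  to a member where the class is algebraic. Implied by HC(2,2)(X) (constant family); converse open.
  `(4,2)`-specific tools: Otwinowska (small-codimension components for hypersurfaces in `ℙ⁵`),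
  Klingler–Otwinowska–Urbanik (typical loci dense in level ≤ 2), Baldi–Klingler–Ullmo (atypical
  loci sparse in level 4 — the dark sector), Movasati–Villaflor / Duque Franco–Villaflor at the
  Fermat sextic, the tadpole bound (route `ShortHodgeVectors`).

`VerticalSupportFourfolds_of : V42 → An42 → VerticalSupportFourfolds` — anchor datum of `(X,c)`,
transport from `s₀` to `s₁`, iso-invariance of `algebraicClasses` (`HodgeTheory/IsoTransport`),
`le_sup_left` (the net `pr` is not used: on fourfolds verticality = algebraicity, IdeatorFour P0 /
IdeatorFive §1). The same term is published stub-free as `Cruxes/VerticalSupportFourfolds/Split.lean`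
(`Theorems.VerticalSupportFourfoldsSplit.verticalSupportFourfolds_of_subs`); the route-level split
(`route edit --split`, D-0027 A7) is for the lead's final cycle — both stubs are open-problem-sized
SUB-CRUXES, not worker tasks (line card `Lines/anchor-transport-42.md`).

Disproof used: no `Disproof.lean` exists for this crux; the stubs honour the would-be
`_false_without_IsRationalClass` (IdeatorFive §1: `TypeOnly` false at the very general sextic) —
rationality of `c` is load-bearing in An42 (an anchor datum forces it, `Split.lean`
`isRationalClass_and_isOfHodgeType_of_anchor`) and in V42 (fibrewise rationality hypothesis).
-/

noncomputable section

open CategoryTheory AlgebraicGeometry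
open Literature.AlgebraicGeometry Literature.AlgebraicGeometry.Motives
  Literature.AlgebraicGeometry.HodgeTheory

namespace Summit.HodgeConjecture.HodgeConjecture.Cruxes.VerticalSupportFourfolds.AnchorTransport42

/-- **Stub 1 (V42) — variational Hodge conjecture for `(2,2)`-classes in families of fourfolds**
(Grothendieck 1966 fn. 13; Charles–Schnell Conj. 11.3.1, global-class form; the `(4,2)` slice of
`AnchorTransport.VariationalHodge`, stmt-HodgeConjecture-1076). OPEN (sub-crux); known for
semiregular lci cycles / semiregular sheaves, Mukai vectors in CY2 categories, Weil classes on the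
Weil locus of abelian fourfolds, and formally in characteristic zero (BEK 2014).
[cite: CharlesSchnell2014Notes, Conj. 11.3.1] -/
theorem stub_variationalHodgeFourfolds :
    ∀ ⦃𝒳 S : SchemeOver ℂ⦄ (f : 𝒳 ⟶ S), IsSmoothProjectiveFamily f 4 → IrreducibleSpace S.left →
      AlgebraicGeometry.Smooth S.hom → ∀ A : complexBetti 𝒳 (2 * 2),
        (∀ s : ComplexPoints S, IsRationalClass (complexBetti.map (fiberι f s) (2 * 2) A) ∧
          IsOfHodgeType 4 (fiberOver f s) (2 * 2) 2 2 (complexBetti.map (fiberι f s) (2 * 2) A)) →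
        (∃ s₀ : ComplexPoints S,
          complexBetti.map (fiberι f s₀) (2 * 2) A ∈ algebraicClasses (fiberOver f s₀) 2) →
        ∀ s : ComplexPoints S,
          complexBetti.map (fiberι f s) (2 * 2) A ∈ algebraicClasses (fiberOver f s) 2 := by
  sorry

/-- **Stub 2 (An42) — anchor existence for `(2,2)`-classes on fourfolds** (geography of Hodge loci;
the `(4,2)` slice of `AnchorTransport.AnchorExistence`, stmt-HodgeConjecture-1077). OPEN
(sub-crux); trivially implied by HC(2,2)(X) through the constant family `X ⟶ Spec ℂ`.
[cite: CattaniDeligneKaplan1995JAMS, Thm. 1.1] [cite: BaldiKlinglerUllmo2024, Thm. 1.5] -/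
theorem stub_anchorExistenceFourfolds :
    ∀ ⦃X : SchemeOver ℂ⦄, IsSmoothProjective 4 X → ∀ c : complexBetti X (2 * 2),
      IsRationalClass c → IsOfHodgeType 4 X (2 * 2) 2 2 c →
        ∃ (𝒳 S : SchemeOver ℂ) (f : 𝒳 ⟶ S) (s₁ s₀ : ComplexPoints S) (e : X ≅ fiberOver f s₁)
          (A : complexBetti 𝒳 (2 * 2)),
          IsSmoothProjectiveFamily f 4 ∧ IrreducibleSpace S.left ∧ AlgebraicGeometry.Smooth S.hom ∧
          (∀ s : ComplexPoints S, IsRationalClass (complexBetti.map (fiberι f s) (2 * 2) A) ∧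
            IsOfHodgeType 4 (fiberOver f s) (2 * 2) 2 2 (complexBetti.map (fiberι f s) (2 * 2) A)) ∧
          complexBetti.map e.hom (2 * 2) (complexBetti.map (fiberι f s₁) (2 * 2) A) = c ∧
          complexBetti.map (fiberι f s₀) (2 * 2) A ∈ algebraicClasses (fiberOver f s₀) 2 := by
  sorry

/-- **Algebraic classes are transported by isomorphisms of `ℂ`-schemes** (`e^* c` algebraic for
`c` algebraic, `e : X ≅ Y`): the backward implication of the tree's hypothesis-free
`mem_algebraicClasses_map_iff_of_iso` (`HodgeTheory/IsoTransport`). PROVED input, not a stub.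
[cite: GrothendieckTopology1969, §1] -/
theorem algebraicClasses_map_of_iso {X Y : SchemeOver ℂ} (e : X ≅ Y) (p : ℕ)
    {c : complexBetti Y (2 * p)} (hc : c ∈ algebraicClasses Y p) :
    complexBetti.map e.hom (2 * p) c ∈ algebraicClasses X p :=
  (mem_algebraicClasses_map_iff_of_iso e).2 hc

/-- **Composition** — the two stubs imply the crux BY NAME: take the anchor datum of a rational
`(2,2)`-class `c` on the fourfold `X` (stub 2), transport algebraicity from the anchor fibre `s₀`
to `s₁` (stub 1) and across `e : X ≅ 𝒳_{s₁}` (`algebraicClasses_map_of_iso`); the algebraic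
classes are the first summand of the crux's right-hand side (`le_sup_left`). Sorry-free; the
sorries of this file sit only inside the two `stub_*`. [cite: CharlesSchnell2014Notes, Conj. 11.3.1 and Cor. 11.3.6] -/
theorem VerticalSupportFourfolds_of
    (hV : ∀ ⦃𝒳 S : SchemeOver ℂ⦄ (f : 𝒳 ⟶ S), IsSmoothProjectiveFamily f 4 → IrreducibleSpace S.left →
      AlgebraicGeometry.Smooth S.hom → ∀ A : complexBetti 𝒳 (2 * 2),
        (∀ s : ComplexPoints S, IsRationalClass (complexBetti.map (fiberι f s) (2 * 2) A) ∧
          IsOfHodgeType 4 (fiberOver f s) (2 * 2) 2 2 (complexBetti.map (fiberι f s) (2 * 2) A)) →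
        (∃ s₀ : ComplexPoints S,
          complexBetti.map (fiberι f s₀) (2 * 2) A ∈ algebraicClasses (fiberOver f s₀) 2) →
        ∀ s : ComplexPoints S,
          complexBetti.map (fiberι f s) (2 * 2) A ∈ algebraicClasses (fiberOver f s) 2)
    (hAn : ∀ ⦃X : SchemeOver ℂ⦄, IsSmoothProjective 4 X → ∀ c : complexBetti X (2 * 2),
      IsRationalClass c → IsOfHodgeType 4 X (2 * 2) 2 2 c →
        ∃ (𝒳 S : SchemeOver ℂ) (f : 𝒳 ⟶ S) (s₁ s₀ : ComplexPoints S) (e : X ≅ fiberOver f s₁)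
          (A : complexBetti 𝒳 (2 * 2)),
          IsSmoothProjectiveFamily f 4 ∧ IrreducibleSpace S.left ∧ AlgebraicGeometry.Smooth S.hom ∧
          (∀ s : ComplexPoints S, IsRationalClass (complexBetti.map (fiberι f s) (2 * 2) A) ∧
            IsOfHodgeType 4 (fiberOver f s) (2 * 2) 2 2 (complexBetti.map (fiberι f s) (2 * 2) A)) ∧
          complexBetti.map e.hom (2 * 2) (complexBetti.map (fiberι f s₁) (2 * 2) A) = c ∧
          complexBetti.map (fiberι f s₀) (2 * 2) A ∈ algebraicClasses (fiberOver f s₀) 2) :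
    Summit.HodgeConjecture.HodgeConjecture.Theses.CurveNetMordellWeil.VerticalSupportFourfolds := by
  intro X pr hX _
  refine le_trans (Submodule.span_le.2 ?_) le_sup_left
  rintro c ⟨hc, hpp⟩
  obtain ⟨𝒳, S, f, s₁, s₀, e, A, hf, hirr, hsm, hfib, hAc, hs₀⟩ := hAn hX c hc hpp
  have h₁ := hV f hf hirr hsm A hfib ⟨s₀, hs₀⟩ s₁
  have h₂ := algebraicClasses_map_of_iso e 2 h₁
  rw [hAc] at h₂
  exact h₂

/-- The crux from the two stubs (the line's claim, modulo the two sorried sub-cruxes).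
[cite: CharlesSchnell2014Notes, Conj. 11.3.1] -/
theorem verticalSupportFourfolds_of_stubs :
    Summit.HodgeConjecture.HodgeConjecture.Theses.CurveNetMordellWeil.VerticalSupportFourfolds :=
  VerticalSupportFourfolds_of stub_variationalHodgeFourfolds stub_anchorExistenceFourfolds

end Summit.HodgeConjecture.HodgeConjecture.Cruxes.VerticalSupportFourfolds.AnchorTransport42

end
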